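import Literature.AlgebraicGeometry.Frobenioids.Thm42SubWeak
import Literature.AlgebraicGeometry.Frobenioids.Thm42DivEquivalentPreserved
import Literature.AlgebraicGeometry.Frobenioids.Thm42PrimaryStepsWeak
import Literature.AlgebraicGeometry.Frobenioids.Thm42DivIdentityWeak
import Literature.AlgebraicGeometry.Frobenioids.PrimesEquivWeak
import Literature.AlgebraicGeometry.Frobenioids.GroupLikeObjectsWLOG
import Literature.AlgebraicGeometry.Frobenioids.FrobeniusTypeIsotropic
import HarnessLib

/-!
# [FrdI] Theorem 4.2 in the WEAK setting: the Setting-level lemmas of the proof of Thm. 4.9, for weakly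
# perf-factorial divisor monoids

Mochizuki, *The geometry of Frobenioids I: the general theory*, Kyushu J. Math. **62** (2008)
293–400, §4, Theorem 4.2, proof p. 78 l. 28 – p. 81 [cite: MochizukiFrdI2008, Thm. 4.2 p.78]; Theorem 4.9,
proof p. 89 – p. 90 (the sentence p. 90: "since `Ψ` preserves pre-steps [cf. Theorem 3.4, (ii)], primary steps
[cf. Theorem 4.2, (i)], Div-equivalent pairs of base-isomorphisms [cf. Theorem 4.2, (ii); the fact that `Φ_i`
is non-dilating]") [cite: MochizukiFrdI2008, Thm. 4.9 p.90].

PROOF-ONLY file (cell abc-iut, layer L1, seat abc-iut-L1-t14; row «C411iii/iv-WEAK» = the [FrdI] Thm. 4.9 /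
Cor. 4.11 (iii)(iv) chain over `IsPerfFactorialWeak`, block (Σ)). WEAK-HYPOTHESIS TWINS, over the structure of
hypotheses `FrdI.T42.SettingWeak` (`Thm42SubWeak.lean`: `T42.Setting` with "`Φ_i` perf-factorial" weakened to
"`Φ_i` weakly perf-factorial", Def. 2.4 (i) (a)(b)(c) + (d_ord) + (d_res); cell finding F-L2d2-1), of the
`T42.Setting`-level lemmas that the tree's kernel proof of Thm. 4.9 consumes:
* `FrdI.T42.Setting.weak` (the printed case: a `Setting` is a `SettingWeak`, via `IsPerfFactorial.weak`),
  `FrdI.T42.SettingWeak.symm` (twin of `Setting.symm`, `Thm42Assembly.lean`);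
* `SettingWeak.isPreStep_of_map`, `SettingWeak.isPrimaryPreStep_map`, `SettingWeak.isPrimaryPreStep_inverse_map`
  (Thm. 4.2 (i), primary steps — twins of the `Thm42PrimaryStepsPropagation/Reflect.lean` lemmas, through the
  weak perfect-type forms `PreFrobenioid.isPrimaryPreStep_map_of_preSteps_weak` / `…_inverse_map_of_preSteps_weak`
  of `Thm42PrimaryStepsWeak.lean`, seat abc-iut-L1-t12);
* `SettingWeak.isGroupLikeObj_map` (twin of `Thm42SubProofsL02.lean`'s, verbatim: no monoid hypothesis enters);
* `SettingWeak.isDivIdentity_map`, `SettingWeak.isDivFrobeniusTrivial_map`,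
  `SettingWeak.isUniversallyDivFrobeniusTrivial_map`, `thm42i_of_settingWeak` (Thm. 4.2 (i) in the weak setting —
  twins of `Thm42Assembly.lean`'s, through `FrdI.T42.isDivIdentity_map_weak` of `Thm42DivIdentityWeak.lean`);
* `SettingWeak.isBaseIso_map`, `SettingWeak.exists_primesEquiv_naturality_baseIso`, `SettingWeak.divEquivalent_map`
  (`Ψ^Prime` functorial on `C^bs-iso` and "`Ψ` preserves Div-equivalent pairs of base-isomorphisms" — twins of
  `Thm42DivEquivalentPreserved.lean`'s, verbatim over `existsUnique_primesEquiv_weak` (`PrimesEquivWeak.lean`) and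
  `primesEquiv_naturality_baseIso_mem_weak` (`Thm42DivIdentityWeak.lean`)).
The printed case (Def. 2.4 (i) (a)–(d)) of each is the strong lemma itself, equivalently the weak one at `S.weak`.
No new definitions; no landed declaration touched; a named hypothesis WEAKENED, nothing of the paper restated or
strengthened; nothing here is specific to the abc programme and no side is taken on [IUTchIII] Cor. 3.12.
-/

namespace Literature.AlgebraicGeometry.Frobenioids

open CategoryTheory Opposite

namespace FrdI.T42

universe w v v' u u'

variable {D₁ : Type u} [Category.{v} D₁] {Φ₁ : D₁ᵒᵖ ⥤ CommMonCat.{w}} {C₁ : Type u'} [Category.{v'} C₁]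
  {D₂ : Type u} [Category.{v} D₂] {Φ₂ : D₂ᵒᵖ ⥤ CommMonCat.{w}} {C₂ : Type u'} [Category.{v'} C₂]
  {F₁ : C₁ ⥤ ElemFrobenioid Φ₁} {F₂ : C₂ ⥤ ElemFrobenioid Φ₂} {Ψ : C₁ ≌ C₂}

/-! ### The printed case and the symmetry -/

/-- **The printed case** (Def. 2.4 (i) (a)–(d)): a `T42.Setting` is a `T42.SettingWeak`, the monoid fields
through `IsPerfFactorial.weak` ((d) ⇒ (d_ord), (d_res)). [cite: MochizukiFrdI2008, Def. 2.4(i) p.47] -/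
theorem Setting.weak (S : Setting F₁ F₂ Ψ) : SettingWeak F₁ F₂ Ψ where
  isFrobenioid₁ := S.isFrobenioid₁
  isFrobenioid₂ := S.isFrobenioid₂
  perfect₁ := S.perfect₁
  perfect₂ := S.perfect₂
  isotropic₁ := S.isotropic₁
  isotropic₂ := S.isotropic₂
  perfFactorial₁ := fun X => (S.perfFactorial₁ X).weak
  perfFactorial₂ := fun X => (S.perfFactorial₂ X).weak
  preStep_map := S.preStep_map
  preStep_inv := S.preStep_inv
  step_map := S.step_map
  step_inv := S.step_inv
  frobeniusType_map := S.frobeniusType_map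
  frobeniusType_inv := S.frobeniusType_inv
  degFr_map := S.degFr_map
  pullback_map := S.pullback_map
  pullback_inv := S.pullback_inv

/-- **The weak setting is symmetric**: the setting for the quasi-inverse `Ψ⁻¹ : C₂ ⥲ C₁` (twin of
`Setting.symm`; Frobenius degrees of `Ψ⁻¹ φ` from those of `Ψ (Ψ⁻¹ φ) ≅ φ`, Thm. 3.4 (iii)).
[cite: MochizukiFrdI2008, Thm. 4.2 p.78] -/
theorem SettingWeak.symm (S : SettingWeak F₁ F₂ Ψ) : SettingWeak F₂ F₁ Ψ.symm where
  isFrobenioid₁ := S.isFrobenioid₂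
  isFrobenioid₂ := S.isFrobenioid₁
  perfect₁ := S.perfect₂
  perfect₂ := S.perfect₁
  isotropic₁ := S.isotropic₂
  isotropic₂ := S.isotropic₁
  perfFactorial₁ := S.perfFactorial₂
  perfFactorial₂ := S.perfFactorial₁
  preStep_map := fun _ _ φ hφ => S.preStep_inv φ hφ
  preStep_inv := fun _ _ φ hφ => S.preStep_map φ hφ
  step_map := fun _ _ φ hφ => S.step_inv φ hφ
  step_inv := fun _ _ φ hφ => S.step_map φ hφ
  frobeniusType_map := fun _ _ φ hφ => S.frobeniusType_inv φ hφ
  frobeniusType_inv := fun _ _ φ hφ => S.frobeniusType_map φ hφ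
  degFr_map := fun X Y φ => by
    have h := S.degFr_map (Ψ.inverse.map φ)
    let iX : Ψ.functor.obj (Ψ.inverse.obj X) ≅ X := Ψ.counitIso.app X
    let iY : Ψ.functor.obj (Ψ.inverse.obj Y) ≅ Y := Ψ.counitIso.app Y
    have e1 : Ψ.functor.map (Ψ.inverse.map φ) = iX.hom ≫ φ ≫ iY.inv := Equivalence.fun_inv_map Ψ X Y φ
    have e2 : PreFrobenioid.degFr F₂ (iX.hom ≫ φ ≫ iY.inv) = PreFrobenioid.degFr F₂ φ :=
      (PreFrobenioid.degFr_iso_comp (F := F₂) iX.hom (φ ≫ iY.inv)).trans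
        (PreFrobenioid.degFr_comp_iso (F := F₂) φ iY.inv)
    exact ((congrArg (PreFrobenioid.degFr F₂) e1).symm.trans h).symm.trans e2
  pullback_map := fun _ _ φ hφ => S.pullback_inv φ hφ
  pullback_inv := fun _ _ φ hφ => S.pullback_map φ hφ

/-! ### Thm. 4.2 (i): pre-steps reflected, primary pre-steps preserved by `Ψ` and `Ψ⁻¹` -/

/-- In the weak setting, `Ψ` REFLECTS pre-steps: if `Ψ(f)` is a pre-step then so is `f` (Thm. 3.4 (ii) for the
quasi-inverse and Prop. 1.7 (v); twin of `Setting.isPreStep_of_map`, no monoid hypothesis enters).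
[cite: MochizukiFrdI2008, Thm. 3.4 (ii) p.62] -/
theorem SettingWeak.isPreStep_of_map (S : SettingWeak F₁ F₂ Ψ) {X Y : C₁} (f : X ⟶ Y)
    (h : PreFrobenioid.IsPreStep F₂ (Ψ.functor.map f)) : PreFrobenioid.IsPreStep F₁ f := by
  have hD₁ := S.isFrobenioid₁.isPreFrobenioid.isTotallyEpimorphic_base
  have h₂ : PreFrobenioid.IsPreStep F₁ (Ψ.inverse.map (Ψ.functor.map f)) := S.preStep_inv _ h
  rw [Ψ.inv_fun_map] at h₂
  exact (PreFrobenioid.isPreStep_factors F₁ hD₁ (PreFrobenioid.isPreStep_factors F₁ hD₁ h₂).1).2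

/-- **`Ψ` preserves primary pre-steps in the weak setting** (Thm. 4.2 (i), p. 78: perfect and isotropic type,
`Φ_i` weakly perf-factorial, Thm. 3.4 (ii) for `Ψ` and a quasi-inverse) — the weak perfect-type form
`PreFrobenioid.isPrimaryPreStep_map_of_preSteps_weak` at the fields of the setting; twin of
`Setting.isPrimaryPreStep_map`. [cite: MochizukiFrdI2008, Thm. 4.2 (i) p.78] -/
theorem SettingWeak.isPrimaryPreStep_map (S : SettingWeak F₁ F₂ Ψ) {A B : C₁} {φ : A ⟶ B}
    (hφ : PreFrobenioid.IsPrimaryPreStep F₁ φ) :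
    PreFrobenioid.IsPrimaryPreStep F₂ (Ψ.functor.map φ) :=
  PreFrobenioid.isPrimaryPreStep_map_of_preSteps_weak Ψ S.isFrobenioid₁ S.isFrobenioid₂ S.perfect₁ S.perfect₂
    S.isotropic₁ S.isotropic₂ S.perfFactorial₁ S.perfFactorial₂ S.step_map S.preStep_map S.preStep_inv hφ

/-- **`Ψ⁻¹` preserves primary pre-steps in the weak setting** (the previous statement for the quasi-inverse);
twin of `Setting.isPrimaryPreStep_inverse_map`. [cite: MochizukiFrdI2008, Thm. 4.2 (i) p.78] -/
theorem SettingWeak.isPrimaryPreStep_inverse_map (S : SettingWeak F₁ F₂ Ψ) {A B : C₂} {φ : A ⟶ B}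
    (hφ : PreFrobenioid.IsPrimaryPreStep F₂ φ) :
    PreFrobenioid.IsPrimaryPreStep F₁ (Ψ.inverse.map φ) :=
  PreFrobenioid.isPrimaryPreStep_inverse_map_of_preSteps_weak Ψ S.isFrobenioid₁ S.isFrobenioid₂ S.perfect₁
    S.perfect₂ S.isotropic₁ S.isotropic₂ S.perfFactorial₁ S.perfFactorial₂ S.step_inv S.preStep_map
    S.preStep_inv hφ

/-! ### Group-like objects, Div-identity endomorphisms, Div-Frobenius-trivial objects -/

set_option backward.isDefEq.respectTransparency false in
/-- In the weak setting (Frobenioids of isotropic type, `Ψ⁻¹` carrying steps to steps), `Ψ` carries group-like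
objects to group-like objects ("`Ψ` preserves non-group-like objects [cf. Theorem 3.4, (ii)]", p. 78 l. 33,
applied to `Ψ⁻¹`); twin of `Setting.isGroupLikeObj_map`, verbatim (no monoid hypothesis enters).
[cite: MochizukiFrdI2008, Thm. 4.2 (i) p.78] -/
theorem SettingWeak.isGroupLikeObj_map (S : SettingWeak F₁ F₂ Ψ) {A : C₁}
    (hA : PreFrobenioid.IsGroupLikeObj F₁ A) : PreFrobenioid.IsGroupLikeObj F₂ (Ψ.functor.obj A) := by
  by_contra h
  obtain ⟨x, hx⟩ := not_forall.mp h
  obtain ⟨B₂, α₂, hα₂, -⟩ := PreFrobenioid.exists_step_of_ne_one F₂ S.isFrobenioid₂ hx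
  have hA' : PreFrobenioid.IsGroupLikeObj F₁ (Ψ.inverse.obj (Ψ.functor.obj A)) :=
    PreFrobenioid.isGroupLikeObj_of_isBaseIso (Ψ.unitInv.app A)
      (PreFrobenioid.isPreStep_of_isIso F₁ _).2 hA
  exact (PreFrobenioid.not_isGroupLikeObj_of_isStep S.isotropic₁ (S.step_inv α₂ hα₂)).1 hA'

/-- **Thm. 4.2 (i), Div-identity endomorphisms, in the weak setting** with `Φ₂` non-dilating: `Ψ` preserves
Div-identity endomorphisms (`FrdI.T42.isDivIdentity_map_weak`, `Thm42DivIdentityWeak.lean`, fed by the weak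
primary-step transports for `Ψ` and for `Ψ⁻¹`); twin of `Setting.isDivIdentity_map`.
[cite: MochizukiFrdI2008, Thm. 4.2 (i) p.81] -/
theorem SettingWeak.isDivIdentity_map (S : SettingWeak F₁ F₂ Ψ) (hnd₂ : IsNonDilatingOn Φ₂) {A : C₁}
    (α : A ⟶ A) (hα : PreFrobenioid.IsDivIdentity F₁ α) : PreFrobenioid.IsDivIdentity F₂ (Ψ.functor.map α) :=
  FrdI.T42.isDivIdentity_map_weak Ψ S.isFrobenioid₁ S.isFrobenioid₂ S.perfect₁ S.perfect₂ S.isotropic₁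
    S.isotropic₂ S.perfFactorial₁ S.perfFactorial₂ S.preStep_map S.preStep_inv S.frobeniusType_map
    S.pullback_map hnd₂ (fun _ _ _ hφ => S.isPrimaryPreStep_map hφ)
    (fun _ _ _ hφ => S.isPrimaryPreStep_inverse_map hφ) α hα

/-- **Row L02 (b) in the weak setting**: with `Φ₂` non-dilating, `Ψ` preserves Div-Frobenius-trivial objects
(formal transport `PreFrobenioid.isDivFrobeniusTrivial_map` + `SettingWeak.isDivIdentity_map`); twin of
`Setting.isDivFrobeniusTrivial_map`. [cite: MochizukiFrdI2008, Thm. 4.2 (i) p.78] -/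
theorem SettingWeak.isDivFrobeniusTrivial_map (S : SettingWeak F₁ F₂ Ψ) (hnd₂ : IsNonDilatingOn Φ₂) {A : C₁}
    (hA : PreFrobenioid.IsDivFrobeniusTrivial F₁ A) :
    PreFrobenioid.IsDivFrobeniusTrivial F₂ (Ψ.functor.obj A) :=
  PreFrobenioid.isDivFrobeniusTrivial_map Ψ S.frobeniusType_map S.degFr_map
    (fun α hα => S.isDivIdentity_map hnd₂ α hα) hA

/-- **Row L02 (c) in the weak setting**: with `Φ₂` non-dilating, `Ψ` preserves universally Div-Frobenius-trivial
objects (pull-backs preserved by `Ψ⁻¹`, Thm. 3.4 (iii)); twin of `Setting.isUniversallyDivFrobeniusTrivial_map`.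
[cite: MochizukiFrdI2008, Thm. 4.2 (i) p.78] -/
theorem SettingWeak.isUniversallyDivFrobeniusTrivial_map (S : SettingWeak F₁ F₂ Ψ) (hnd₂ : IsNonDilatingOn Φ₂)
    {A : C₁} (hA : PreFrobenioid.IsUniversallyDivFrobeniusTrivial F₁ A) :
    PreFrobenioid.IsUniversallyDivFrobeniusTrivial F₂ (Ψ.functor.obj A) :=
  PreFrobenioid.isUniversallyDivFrobeniusTrivial_map Ψ S.isFrobenioid₂.isPreFrobenioid S.frobeniusType_map
    S.degFr_map S.pullback_inv (fun _ _ _ α hα => S.isDivIdentity_map hnd₂ α hα) hA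

/-- **Theorem 4.2 (i) in the weak setting** (perfect and isotropic type, `Φ_i` weakly perf-factorial,
Thm. 3.4 (ii)(iii) for `Ψ` and `Ψ⁻¹`), given only that `Φ₂` is non-dilating: `Ψ` preserves primary steps,
Div-identity endomorphisms, Div-Frobenius-trivial objects and universally Div-Frobenius-trivial objects; twin of
`thm42i_of_setting`. [cite: MochizukiFrdI2008, Thm. 4.2 (i) p.77] -/
theorem thm42i_of_settingWeak (S : SettingWeak F₁ F₂ Ψ) (hnd₂ : IsNonDilatingOn Φ₂) :
    (∀ ⦃X Y : C₁⦄ (φ : X ⟶ Y), PreFrobenioid.IsStep F₁ φ ∧ PreFrobenioid.IsPrimaryPreStep F₁ φ →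
        PreFrobenioid.IsStep F₂ (Ψ.functor.map φ) ∧ PreFrobenioid.IsPrimaryPreStep F₂ (Ψ.functor.map φ)) ∧
      (∀ (A : C₁) (α : A ⟶ A), PreFrobenioid.IsDivIdentity F₁ α →
        PreFrobenioid.IsDivIdentity F₂ (Ψ.functor.map α)) ∧
      (∀ ⦃A : C₁⦄, PreFrobenioid.IsDivFrobeniusTrivial F₁ A →
        PreFrobenioid.IsDivFrobeniusTrivial F₂ (Ψ.functor.obj A)) ∧
      ∀ ⦃A : C₁⦄, PreFrobenioid.IsUniversallyDivFrobeniusTrivial F₁ A →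
        PreFrobenioid.IsUniversallyDivFrobeniusTrivial F₂ (Ψ.functor.obj A) :=
  ⟨fun _ _ φ hφ => ⟨S.step_map φ hφ.1, S.isPrimaryPreStep_map hφ.2⟩,
    fun _ α hα => S.isDivIdentity_map hnd₂ α hα,
    fun _ hA => S.isDivFrobeniusTrivial_map hnd₂ hA,
    fun _ hA => S.isUniversallyDivFrobeniusTrivial_map hnd₂ hA⟩

/-! ### Base-isomorphisms, `Ψ^Prime` on `C^bs-iso`, Div-equivalent pairs -/

/-- In the weak setting `Ψ` preserves base-isomorphisms (a base-isomorphism is "Frobenius-type ∘ pre-step",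
both preserved; twin of `Setting.isBaseIso_map`, no monoid hypothesis enters).
[cite: MochizukiFrdI2008, Thm. 3.4 (iii) p.62] -/
theorem SettingWeak.isBaseIso_map (S : SettingWeak F₁ F₂ Ψ) {A B : C₁} (γ : A ⟶ B)
    (hγ : PreFrobenioid.IsBaseIso F₁ γ) : PreFrobenioid.IsBaseIso F₂ (Ψ.functor.map γ) := by
  obtain ⟨X, β, α, hfac, hβ, hα⟩ :=
    (PreFrobenioid.isBaseIso_iff_exists_frobeniusType_preStep F₁ S.isFrobenioid₁ γ).1 hγ
  rw [← hfac, Functor.map_comp]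
  exact PreFrobenioid.IsBaseIso.comp F₂ (S.frobeniusType_map β hβ).2 (S.preStep_map α hα).2
set_option backward.isDefEq.respectTransparency false in
/-- **`Ψ^Prime` is functorial on `C^bs-iso`, element form, in the WEAK setting** (Thm. 4.2 (ii), p. 77:
"`Ψ^Prime` … an isomorphism between the functors `A_i ↦ Prime(Φ_i(A_i))` on `C_i^bs-iso`"; proof p. 80
ll. 44–45; twin of `Setting.exists_primesEquiv_naturality_baseIso` over `existsUnique_primesEquiv_weak` /
`primesEquiv_naturality_baseIso_mem_weak`): in the `T42.SettingWeak` there is a family of bijections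
`e_A : Prime(Φ₁(A)) ≃ Prime(Φ₂(Ψ A))` [namely `Ψ^Prime`] such that for EVERY base-isomorphism `γ : A → A′` and
every primary `x ∈ Φ₂((Ψ A′)_D)` of class `e_{A′} 𝔭′`, the element `Φ₂(Base Ψγ)(x)` lies in the class `e_A 𝔭`
whenever `Φ₁(Base γ)` carries `𝔭′` into `𝔭`. [cite: MochizukiFrdI2008, Thm. 4.2 (ii) p.77] -/
theorem SettingWeak.exists_primesEquiv_naturality_baseIso (S : SettingWeak F₁ F₂ Ψ) :
    ∃ e : ∀ A : C₁, Primes (Φ₁.obj (op (PreFrobenioid.baseObj F₁ A))) ≃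
        Primes (Φ₂.obj (op (PreFrobenioid.baseObj F₂ (Ψ.functor.obj A)))),
      ∀ {A A' : C₁} (γ : A ⟶ A'), PreFrobenioid.IsBaseIso F₁ γ →
        ∀ (𝔭 : Primes (Φ₁.obj (op (PreFrobenioid.baseObj F₁ A))))
          (𝔭' : Primes (Φ₁.obj (op (PreFrobenioid.baseObj F₁ A')))),
          (∃ p' ∈ 𝔭'.carrier, pull Φ₁ (PreFrobenioid.Base F₁ γ) p' ∈ 𝔭.carrier) →
            ∀ x ∈ (e A' 𝔭').carrier,
              pull Φ₂ (PreFrobenioid.Base F₂ (Ψ.functor.map γ)) x ∈ (e A 𝔭).carrier := by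
  open PreFrobenioid in
  classical
  have hF₁ := S.isFrobenioid₁
  have hF₂ := S.isFrobenioid₂
  -- the family `e = Ψ^Prime`, one object at a time, with its characteristic property (row T42-L08)
  have H := fun X : C₁ => existsUnique_primesEquiv_weak Ψ hF₁ hF₂ S.isotropic₁ S.isotropic₂
    S.perfFactorial₁ S.perfFactorial₂ S.preStep_map S.preStep_inv X
    (fun E ε hε => S.isPrimaryPreStep_map hε) (fun Z ξ hξ => S.isPrimaryPreStep_inverse_map hξ)
  choose e he using fun X => (H X).exists
  have he' : ∀ (X : C₁) ⦃E : C₁⦄ (ε : E ⟶ X) (hε : IsPrimaryPreStep F₁ ε)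
      (𝔭 : Primes (Φ₁.obj (op (baseObj F₁ X)))), invDiv F₁ ε hε.1.2 ∈ 𝔭.carrier →
        ∀ h₂ : IsBaseIso F₂ (Ψ.functor.map ε), invDiv F₂ (Ψ.functor.map ε) h₂ ∈ (e X 𝔭).carrier :=
    fun X E ε hε 𝔭 h _ => he X ε hε 𝔭 h
  refine ⟨e, fun {A A'} γ hγ 𝔭 𝔭' hrel x hx => ?_⟩
  -- functoriality of `Ψ^Prime` on `C^bs-iso` (rows T42-L09/L10): SOME element of `e 𝔭′` pulls back into `e 𝔭`
  obtain ⟨q', hq', hq'pull⟩ := primesEquiv_naturality_baseIso_mem_weak Ψ hF₁ hF₂ S.perfect₁ S.perfect₂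
    S.isotropic₁ S.isotropic₂ S.perfFactorial₁ S.perfFactorial₂ S.preStep_map S.preStep_inv
    S.frobeniusType_map (fun _ _ _ hφ => S.isPrimaryPreStep_map hφ) e he' γ hγ 𝔭 𝔭' hrel
  -- hence EVERY element of `e 𝔭′` does: `x ≼ q′ ≼ x` and `Φ₂(Base Ψγ)` is monotone
  haveI : IsIso (Base F₂ (Ψ.functor.map γ)) := S.isBaseIso_map γ hγ
  have hxprim : IsPrimary (pull Φ₂ (Base F₂ (Ψ.functor.map γ)) x) :=
    (isPrimary_pull_iff (Base F₂ (Ψ.functor.map γ)) x).mpr hx.1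
  exact Primes.mem_carrier_of_precsim _ hq'pull hxprim.1 ((Primes.precsim_of_mem_carrier _ hx hq').map _)

set_option backward.isDefEq.respectTransparency false in
/-- **`Ψ` preserves Div-equivalent pairs of base-isomorphisms, in the WEAK setting** (twin of
`Setting.divEquivalent_map`, verbatim) — ([FrdI] proof of Thm. 4.9, p. 90
ll. 77–79: "[cf. Theorem 4.2, (ii); the fact that `Φ_i` is non-dilating]"): in the `T42.SettingWeak`, if
`Φ₂` is non-dilating (Def. 1.1 (ii); part of "standard type", Def. 3.1 (i)(e)), then for base-isomorphisms
`φ, ψ : X → Y` of `C₁` with `Φ₁(Base φ) = Φ₁(Base ψ)` one has `Φ₂(Base Ψφ) = Φ₂(Base Ψψ)`. This is the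
binder `hdiveq` of row T49-L08′ (`FrdI.T49.PsiPreservesTwinPrimary'`) and of
`FrdI.T49.exists_twinPrimary_pair_of_isStrictlyRational`, discharged.
[cite: MochizukiFrdI2008, Thm. 4.9 p.90] -/
theorem SettingWeak.divEquivalent_map (S : SettingWeak F₁ F₂ Ψ) (hnd₂ : IsNonDilatingOn Φ₂) {X Y : C₁}
    (φ ψ : X ⟶ Y) (hφ : PreFrobenioid.IsBaseIso F₁ φ) (hψ : PreFrobenioid.IsBaseIso F₁ ψ)
    (h : PreFrobenioid.DivEquivalent F₁ φ ψ) :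
    PreFrobenioid.DivEquivalent F₂ (Ψ.functor.map φ) (Ψ.functor.map ψ) := by
  open PreFrobenioid in
  classical
  have hF₁ := S.isFrobenioid₁
  have hF₂ := S.isFrobenioid₂
  have hP₂ := hF₂.isPreFrobenioid
  obtain ⟨e, he⟩ := S.exists_primesEquiv_naturality_baseIso
  haveI : IsIso (Base F₁ φ) := hφ
  haveI : IsIso (Base F₂ (Ψ.functor.map φ)) := S.isBaseIso_map φ hφ
  haveI : IsIso (Base F₂ (Ψ.functor.map ψ)) := S.isBaseIso_map ψ hψ
  -- the endomorphism `f := Base(Ψψ)⁻¹ ≫ Base(Ψφ)` of `(Ψ Y)_D`; `f^* = Φ₂(Base Ψψ)⁻¹ ∘ Φ₂(Base Ψφ)`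
  let f : baseObj F₂ (Ψ.functor.obj Y) ⟶ baseObj F₂ (Ψ.functor.obj Y) :=
    inv (Base F₂ (Ψ.functor.map ψ)) ≫ Base F₂ (Ψ.functor.map φ)
  -- `f^*` maps every primary `x` `≼`-below itself: both `Φ₂(Base Ψφ)` and `Φ₂(Base Ψψ)` carry the prime of
  -- `x` into ONE prime of `Φ₂((Ψ X)_D)`, namely `e_X 𝔭` for `𝔭 = Φ₁(Base φ)(𝔭′) = Φ₁(Base ψ)(𝔭′)`
  have hle : ∀ x : Φ₂.obj (op (baseObj F₂ (Ψ.functor.obj Y))), IsPrimary x → pull Φ₂ f x ≼ x := by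
    intro x hx
    -- the prime `𝔮′ ∋ x` of `Φ₂((Ψ Y)_D)` is `e_Y 𝔭′`
    obtain ⟨𝔭', h𝔭'⟩ := (e Y).surjective (Quotient.mk _ ⟨x, hx⟩)
    have hx' : x ∈ (e Y 𝔭').carrier := by rw [h𝔭']; exact mem_carrier_mk_of_isPrimary hx
    -- a primary `p′ ∈ 𝔭′` and its pull-back `p = Φ₁(Base φ)(p′) = Φ₁(Base ψ)(p′)`, of class `𝔭`
    obtain ⟨⟨p', hp'⟩, hp'𝔭⟩ := Quotient.exists_rep 𝔭'
    have hp'mem : p' ∈ 𝔭'.carrier := by rw [← hp'𝔭]; exact mem_carrier_mk_of_isPrimary hp'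
    have hpprim : IsPrimary (pull Φ₁ (Base F₁ φ) p') := (isPrimary_pull_iff (Base F₁ φ) p').mpr hp'
    let 𝔭 : Primes (Φ₁.obj (op (baseObj F₁ X))) := Quotient.mk _ ⟨_, hpprim⟩
    have hpmem : pull Φ₁ (Base F₁ φ) p' ∈ 𝔭.carrier := mem_carrier_mk_of_isPrimary hpprim
    have hrelφ : ∃ p' ∈ 𝔭'.carrier, pull Φ₁ (Base F₁ φ) p' ∈ 𝔭.carrier := ⟨p', hp'mem, hpmem⟩
    have hrelψ : ∃ p' ∈ 𝔭'.carrier, pull Φ₁ (Base F₁ ψ) p' ∈ 𝔭.carrier :=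
      ⟨p', hp'mem, by rw [show pull Φ₁ (Base F₁ ψ) = pull Φ₁ (Base F₁ φ) from h.symm]; exact hpmem⟩
    -- naturality along `φ` and along `ψ`
    have h1 : pull Φ₂ (Base F₂ (Ψ.functor.map φ)) x ∈ (e X 𝔭).carrier := he φ hφ 𝔭 𝔭' hrelφ x hx'
    have h2 : pull Φ₂ (Base F₂ (Ψ.functor.map ψ)) x ∈ (e X 𝔭).carrier := he ψ hψ 𝔭 𝔭' hrelψ x hx'
    -- `f^* x = Φ₂(Base Ψψ)⁻¹ (Φ₂(Base Ψφ) x) ≼ Φ₂(Base Ψψ)⁻¹ (Φ₂(Base Ψψ) x) = x`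
    have hcalc : pull Φ₂ f x =
        pull Φ₂ (inv (Base F₂ (Ψ.functor.map ψ))) (pull Φ₂ (Base F₂ (Ψ.functor.map φ)) x) := by
      simp only [f, pull_comp]
    have hback : pull Φ₂ (inv (Base F₂ (Ψ.functor.map ψ))) (pull Φ₂ (Base F₂ (Ψ.functor.map ψ)) x) = x := by
      rw [← pull_comp, IsIso.inv_hom_id, pull_id]
    rw [hcalc]
    have h3 : pull Φ₂ (inv (Base F₂ (Ψ.functor.map ψ))) (pull Φ₂ (Base F₂ (Ψ.functor.map φ)) x) ≼
        pull Φ₂ (inv (Base F₂ (Ψ.functor.map ψ))) (pull Φ₂ (Base F₂ (Ψ.functor.map ψ)) x) :=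
      (Primes.precsim_of_mem_carrier _ h1 h2).map _
    rwa [hback] at h3
  -- `Φ₂` non-dilating ⇒ `f^* = id`
  have hid : pull Φ₂ f = MonoidHom.id _ := pull_eq_id_of_precsim_of_isPrimary hP₂ hnd₂ f hle
  -- conclusion: `Φ₂(Base Ψφ) = Φ₂(Base Ψψ) ∘ f^* = Φ₂(Base Ψψ)`
  unfold DivEquivalent
  ext x
  have hx := congrArg (fun g => pull Φ₂ (Base F₂ (Ψ.functor.map ψ)) (g x)) hid
  simp only [f, pull_comp, MonoidHom.id_apply] at hx
  rw [← pull_comp, ← pull_comp, Category.assoc, IsIso.hom_inv_id_assoc] at hx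
  simpa using hx

end FrdI.T42

end Literature.AlgebraicGeometry.Frobenioids
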